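import Mathlib
import Summits.Ventures.HodgeRepro2.T5CyclotomicSubfieldInertiaDeg
import Summits.Ventures.HodgeRepro2.T5CMFieldCyclicGaloisCriterion

/-!
# THE INERT / SPLIT CENSUS OF A SEXTIC CM SUBFIELD OF `ℚ(ζₘ)`, READ OFF `(ℤ/mℤ)ˣ / H_F`

Tier-5 support N2 / N3 / §G-N4.2 (seat p3, gen 81). File 281 (`T5CMFieldCyclicGaloisCriterion`) is the census of
EVERY sextic Galois CM field `K`: for `p` unramified in `K` and a place `v` of `K⁺` under a prime `P` of `K` above `p`,
«`v` stays prime in `K` ⟺ `f(P/p)` even ⟺ `f(P/p) ∈ {2, 6}`». File 286 (`T5CyclotomicSubfieldInertiaDeg`) computes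
`f(P/p)` for a subfield `F ⊆ ℚ(ζₘ)`: it is the order of `p · H_F` in `(ℤ/mℤ)ˣ / H_F` (`H_F` = the subgroup cutting
out `F`). This file puts the two together for the sextic CM subfields of cyclotomic fields — every sextic Galois CM
field is abelian (file 280 / 281: cyclic), hence by Kronecker–Weber (print) of this form; for a CONCRETE field given as a
subfield of `ℚ(ζₘ)` nothing is left in print:

* `isCMField_of_isTotallyComplex`: a totally complex subfield of `ℚ(ζₘ)` is a CM field (Mathlib's
  `IsCMField.of_isAbelianGalois`); `isGalois`: it is Galois over `ℚ`;
* `inertiaDeg_eq_one_iff_mem`: `p` splits completely in `F` ⟺ `p ∈ H_F` (any subfield `F`);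
* **`exists_map_eq_iff_even_orderOf_mk`**: for `[F : ℚ] = 6`, `F` totally complex, `p ∤ m`: `v` stays prime in `F`
  ⟺ the order of `p · H_F` in `(ℤ/mℤ)ˣ / H_F` is EVEN;
* `ncard_primesOver_eq_one_iff_even_orderOf_mk`, `ncard_primesOver_eq_two_iff_odd_orderOf_mk`,
  **`ncard_primesOver_eq_one_iff_orderOf_mk_eq_two_or_six`** (one prime above `v` ⟺ `ord(p · H_F) ∈ {2, 6}`);
* `sextic_cm_subfield_census`: the three statements in one, with `[F⁺ : ℚ] = 3`.

§8(d): uses an L-value-free non-vanishing device: NO.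
-/

open NumberField IsCyclotomicExtension.Rat Ideal IsDedekindDomain IsDedekindDomain.HeightOneSpectrum
open Summit.Ventures.HodgeRepro2.T5CyclotomicSubfieldInertiaDeg

namespace Summit.Ventures.HodgeRepro2.T5CyclotomicSubfieldSexticCensus

variable (m : ℕ) [NeZero m] (L : Type*) [Field L] [NumberField L] [IsCyclotomicExtension {m} ℚ L]
  (F : IntermediateField ℚ L)

section General

variable (p : ℕ) [hp : Fact p.Prime] (hpm : p.Coprime m)
  (𝔭 : Ideal (𝓞 F)) [h𝔭 : 𝔭.IsPrime] [h𝔭p : 𝔭.LiesOver (span {(p : ℤ)})]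

include hpm h𝔭 h𝔭p in
/-- **`p ∤ m` splits completely in the subfield `F ⊆ ℚ(ζₘ)` iff `p mod m ∈ H_F`** (`f(𝔭/p) = 1 ⟺ p · H_F = 1`). -/
theorem inertiaDeg_eq_one_iff_mem :
    𝔭.inertiaDeg ℤ = 1 ↔ ZMod.unitOfCoprime p hpm ∈ zmodSubgroup m L F := by
  rw [inertiaDeg_eq_orderOf_mk m L F p hpm 𝔭, orderOf_eq_one_iff, QuotientGroup.eq_one_iff]

include m in
/-- A subfield of `ℚ(ζₘ)` is Galois over `ℚ` (file 47). -/
theorem isGalois : IsGalois ℚ F :=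
  T5CyclotomicUnramified.isGalois_intermediateField L m F

omit [NeZero m] in
include m in
/-- **A totally complex subfield of `ℚ(ζₘ)` is a CM field** (it is abelian over `ℚ`; Mathlib's
`IsCMField.of_isAbelianGalois`). -/
theorem isCMField_of_isTotallyComplex [IsTotallyComplex F] : IsCMField F := by
  haveI : IsAbelianGalois ℚ L := IsCyclotomicExtension.isAbelianGalois {m} ℚ L
  haveI : IsAbelianGalois ℚ F := IsAbelianGalois.tower_bot ℚ F L
  exact IsCMField.of_isAbelianGalois F

end General

section Sextic

variable [IsTotallyComplex F] (h6 : Module.finrank ℚ F = 6)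
variable (p : ℕ) [hp : Fact p.Prime] (hpm : p.Coprime m)
  (P : Ideal (𝓞 F)) [hP : P.IsPrime] [hPp : P.LiesOver (span {(p : ℤ)})]
  (v : HeightOneSpectrum (𝓞 (maximalRealSubfield F))) [hPv : P.LiesOver v.asIdeal]

include h6 hpm hP hPp hPv in
/-- **THE CENSUS OF A SEXTIC CM SUBFIELD `F ⊆ ℚ(ζₘ)` AT `p ∤ m`: a place `v` of `F⁺` stays prime in `F` iff the order
of `p · H_F` in `(ℤ/mℤ)ˣ / H_F` is even** (file 281's `exists_map_eq_iff_even_inertiaDeg_sextic` with `f(P/p)` read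
off `(ℤ/mℤ)ˣ / H_F` by file 286). -/
theorem exists_map_eq_iff_even_orderOf_mk :
    (∃ w : HeightOneSpectrum (𝓞 F),
        Ideal.map (algebraMap (𝓞 (maximalRealSubfield F)) (𝓞 F)) v.asIdeal = w.asIdeal) ↔
      Even (orderOf (QuotientGroup.mk (ZMod.unitOfCoprime p hpm) : (ZMod m)ˣ ⧸ zmodSubgroup m L F)) := by
  haveI := isCMField_of_isTotallyComplex m L F
  haveI := isGalois m L F
  rw [← inertiaDeg_eq_orderOf_mk m L F p hpm P]
  exact T5CMFieldCyclicGaloisCriterion.exists_map_eq_iff_even_inertiaDeg_sextic F h6 p P v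
    (T5CyclotomicUnramified.ramificationIdx_eq_one p L F
      ((Nat.Prime.coprime_iff_not_dvd hp.out).mp hpm) P)

include h6 hpm hP hPp hPv in
/-- One prime of `F` above `v` iff `ord(p · H_F)` is even. -/
theorem ncard_primesOver_eq_one_iff_even_orderOf_mk :
    (v.asIdeal.primesOver (𝓞 F)).ncard = 1 ↔
      Even (orderOf (QuotientGroup.mk (ZMod.unitOfCoprime p hpm) : (ZMod m)ˣ ⧸ zmodSubgroup m L F)) := by
  haveI := isCMField_of_isTotallyComplex m L F
  haveI := isGalois m L F
  haveI := T5CMFieldCyclicGaloisCriterion.isCyclic_gal F h6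
  rw [← inertiaDeg_eq_orderOf_mk m L F p hpm P]
  exact T5CMFieldCyclicGaloisCriterion.ncard_primesOver_eq_one_iff_even_inertiaDeg F p P v
    (T5CyclotomicUnramified.ramificationIdx_eq_one p L F
      ((Nat.Prime.coprime_iff_not_dvd hp.out).mp hpm) P)

include h6 hpm hP hPp hPv in
/-- Two primes of `F` above `v` iff `ord(p · H_F)` is odd. -/
theorem ncard_primesOver_eq_two_iff_odd_orderOf_mk :
    (v.asIdeal.primesOver (𝓞 F)).ncard = 2 ↔
      Odd (orderOf (QuotientGroup.mk (ZMod.unitOfCoprime p hpm) : (ZMod m)ˣ ⧸ zmodSubgroup m L F)) := by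
  haveI := isCMField_of_isTotallyComplex m L F
  haveI := isGalois m L F
  haveI := T5CMFieldCyclicGaloisCriterion.isCyclic_gal F h6
  rw [← inertiaDeg_eq_orderOf_mk m L F p hpm P]
  exact T5CMFieldCyclicGaloisCriterion.ncard_primesOver_eq_two_iff_odd_inertiaDeg F p P v
    (T5CyclotomicUnramified.ramificationIdx_eq_one p L F
      ((Nat.Prime.coprime_iff_not_dvd hp.out).mp hpm) P)

include h6 hpm hP hPp hPv in
/-- **One prime of `F` above `v` iff `ord(p · H_F) ∈ {2, 6}`** (`f(P/p) ∣ 6`). -/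
theorem ncard_primesOver_eq_one_iff_orderOf_mk_eq_two_or_six :
    (v.asIdeal.primesOver (𝓞 F)).ncard = 1 ↔
      orderOf (QuotientGroup.mk (ZMod.unitOfCoprime p hpm) : (ZMod m)ˣ ⧸ zmodSubgroup m L F) = 2 ∨
        orderOf (QuotientGroup.mk (ZMod.unitOfCoprime p hpm) : (ZMod m)ˣ ⧸ zmodSubgroup m L F) = 6 := by
  haveI := isGalois m L F
  rw [ncard_primesOver_eq_one_iff_even_orderOf_mk m L F h6 p hpm P v,
    ← inertiaDeg_eq_orderOf_mk m L F p hpm P]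
  exact T5CMFieldCyclicGaloisCriterion.even_inertiaDeg_iff_sextic F h6 p P

include h6 hpm hP hPp hPv in
/-- **THE SEXTIC CM SUBFIELD CENSUS IN ONE STATEMENT**: `F ⊆ ℚ(ζₘ)` totally complex of degree `6` is a CM field
with `[F⁺ : ℚ] = 3`; for `p ∤ m`, `P ∣ v ∣ p`: `v` stays prime in `F` ⟺ `ord(p · H_F)` even; one prime above `v`
⟺ `ord(p · H_F) ∈ {2, 6}`; two primes above `v` ⟺ `ord(p · H_F)` odd; `p` splits completely ⟺ `p ∈ H_F`. -/
theorem sextic_cm_subfield_census :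
    IsCMField F ∧ Module.finrank ℚ (maximalRealSubfield F) = 3 ∧
      ((∃ w : HeightOneSpectrum (𝓞 F),
          Ideal.map (algebraMap (𝓞 (maximalRealSubfield F)) (𝓞 F)) v.asIdeal = w.asIdeal) ↔
        Even (orderOf (QuotientGroup.mk (ZMod.unitOfCoprime p hpm) : (ZMod m)ˣ ⧸ zmodSubgroup m L F))) ∧
      ((v.asIdeal.primesOver (𝓞 F)).ncard = 1 ↔
        orderOf (QuotientGroup.mk (ZMod.unitOfCoprime p hpm) : (ZMod m)ˣ ⧸ zmodSubgroup m L F) = 2 ∨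
          orderOf (QuotientGroup.mk (ZMod.unitOfCoprime p hpm) : (ZMod m)ˣ ⧸ zmodSubgroup m L F) = 6) ∧
      ((v.asIdeal.primesOver (𝓞 F)).ncard = 2 ↔
        Odd (orderOf (QuotientGroup.mk (ZMod.unitOfCoprime p hpm) : (ZMod m)ˣ ⧸ zmodSubgroup m L F))) ∧
      (P.inertiaDeg ℤ = 1 ↔ ZMod.unitOfCoprime p hpm ∈ zmodSubgroup m L F) := by
  haveI := isCMField_of_isTotallyComplex m L F
  exact ⟨inferInstance, T5CMFieldCyclicGaloisCriterion.finrank_maximalRealSubfield F h6,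
    exists_map_eq_iff_even_orderOf_mk m L F h6 p hpm P v,
    ncard_primesOver_eq_one_iff_orderOf_mk_eq_two_or_six m L F h6 p hpm P v,
    ncard_primesOver_eq_two_iff_odd_orderOf_mk m L F h6 p hpm P v,
    inertiaDeg_eq_one_iff_mem m L F p hpm P⟩

end Sextic

end Summit.Ventures.HodgeRepro2.T5CyclotomicSubfieldSexticCensus
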